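import Literature.Geometry.Symplectic.SphereCRSolutionRegularity
import Literature.Geometry.Symplectic.SphereCROperatorVariation
import HarnessLib

/-!
# Linear elliptic regularity for the linearised chart equation of a sphere

Layer B7c of the analytic core of the Hofer–Lizan–Sikorav local foliation theorem (Wendl 2018,
Thm. 2.46 / Prop. 2.53), as used by the lead of crux `WitnessCharge` (summit `SmoothPoincare4`).
The implicit function theorem produces the family of `J`-holomorphic spheres in a fixed Hölder
class; to lift it to all classes one needs, besides the regularity of each solution
(`SphereCRSolutionRegularity`), the regularity of the solutions `(δξ, δf)` of the LINEARISED
chart equation at a smooth small solution `(ξ₁, f₁)`. By the first variation formula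
(`SphereCROperatorVariation.hasDerivAt_crOp₀_variation`) that equation reads, near a point `z₀` of
the chart,

  `ρ z • Φ₀ ξ₁ f₁ z (∂ₓη + J₀ (v₁ z) ∂_yη + (DJ₀ (v₁ z) (η z)) (∂_y v₁ z)) = G z`,

with the variation field `η = dvmap₀ ξ₁ δξ δf`, the base curve `v₁ = vmap₀ ξ₁ f₁`, the
(invertible) transport `Φ₀ ξ₁ f₁ z = PhiJet₀ z (ξ₁ z) (f₁ z)` and a cutoff `ρ` with `ρ z₀ ≠ 0`.

**Theorem** (`locHolder_succ_of_linearised`; McDuff–Salamon 2012, Thm. B.4.1, linear Hölder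
version). If `G` is of local class `C^{m,r}` near `z₀` (`0 < r < 1`) and `(δξ, δf)` of local class
`C^{1,r}`, then `(δξ, δf)` is of local class `C^{m+1,r}` near `z₀`.

Proof. Inverting `ρ Φ₀` (inversion is smooth on the units of the Banach algebra `End_ℝ(ℂ × ℂ)`)
gives `∂ₓη + J₀(v₁) ∂_yη + (DJ₀(v₁) η) ∂_y v₁ = E` with `E` of local class `C^{m,r}`; transporting
to `ℝ⁴` by the fixed isomorphism `toE4` this is the first-order system `∂ₓu + A ∂_y u = F` of the
tree's bootstrapping `locHolder_succ_of_linearCR` (`A = coefE4 ∘ v₁` smooth, `A² = -1`, and `F`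
of the class of `η` capped at `m`), which raises the class of `u = toE4 ∘ η` one step at a time
(`locHolder_succ_of_linearisedCR`). Finally `η z = (P z (ξ₁ z) δξ z, Q₀(z)⁻¹ δf z)` with `P ≠ 0`
smooth (`fderivExpChart_apply_zero_left`), so `(δξ, δf)` has the class of `η`.

## Contents

* `locHolder_of_contDiffOn`, `locHolder_of_contDiff` — maps smooth near `z₀` are of every local
  Hölder class near `z₀`;
* `fderivExpChart_apply_zero_left` — `D(expChart)(z, c) (0, b) = P z c * b`;
* `dvmap₀_eq_P_mul`, `locHolder_dvmap₀`, `locHolder_of_locHolder_dvmap₀` — the variation field has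
  exactly the local class of the direction;
* `locHolder_succ_of_linearisedCR` — linear regularity for `∂ₓη + J₀(v) ∂_yη + (DJ₀(v) η) ∂_y v = E`
  along any smooth curve `v`;
* `contDiffOn_PhiJet₀_apply`, `isOpen_den_ne_zero_and_isUnit_PhiJet₀`,
  `contDiffOn_inverse_PhiJet₀_apply` — the transport and its inverse along smooth data;
* `locHolder_succ_of_linearised` (MAIN), and chart `1` (via `𝒥.swap`): `swap_dvmap₀_apply`,
  `swap_PhiJet₀`, `locHolder_succ_of_linearised₁`.

## References

* D. McDuff, D. Salamon, *J-holomorphic Curves and Symplectic Topology*, 2nd ed. (2012), App. B.4,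
  Thm. B.4.1; §3.1. [McDuffSalamon2012]
* C. Wendl, *Holomorphic Curves in Low Dimensions*, LNM 2216 (2018), §2.3, Thm. 2.46. [Wendl2018]
-/

noncomputable section

open Complex Set Filter Function
open scoped Topology NNReal ContDiff ComplexConjugate
open Literature.Analysis.Complex Literature.Analysis.Complex.ProjectiveLineExpChart
  Literature.Analysis.FunctionSpaces Literature.Geometry.Symplectic.CRExpression

namespace Literature.Geometry.Symplectic

/-! ### Maps smooth near a point are of every local Hölder class -/

section LocHolderSmooth

variable {Z : Type} [NormedAddCommGroup Z] [NormedSpace ℝ Z] {r : ℝ≥0} {z₀ : ℂ}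

/-- A map which is `C^∞` on an open neighbourhood of `z₀` is of local class `C^{k,r}` near `z₀`
for every `k` (`r ≤ 1`). [folklore] -/
theorem locHolder_of_contDiffOn (hr : r ≤ 1) (k : ℕ) {a : ℂ → Z} {U : Set ℂ} (hU : IsOpen U)
    (ha : ContDiffOn ℝ ∞ a U) (h0 : z₀ ∈ U) :
    ∃ W, MemContDiffHolder k r W ∧ W =ᶠ[𝓝 z₀] a := by
  have hΦ : ContDiffOn ℝ ∞ (fun p : ℂ × ℝ => a p.1) (U ×ˢ univ) :=
    ha.comp contDiffOn_fst fun p hp => hp.1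
  exact locHolder_comp_of_contDiffOn hr (hU.prod isOpen_univ) hΦ (u := fun _ => (0 : ℝ))
    ⟨h0, mem_univ _⟩ (locHolder_zero k)

/-- A globally `C^∞` map is of local class `C^{k,r}` near every point, for every `k` (`r ≤ 1`).
[folklore] -/
theorem locHolder_of_contDiff (hr : r ≤ 1) (k : ℕ) {a : ℂ → Z} (ha : ContDiff ℝ ∞ a) :
    ∃ W, MemContDiffHolder k r W ∧ W =ᶠ[𝓝 z₀] a :=
  locHolder_of_contDiffOn hr k isOpen_univ ha.contDiffOn (mem_univ _)

end LocHolderSmooth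

namespace SphereCR

/-! ### The fibre derivative of the exponential chart -/

/-- **The differential of the exponential chart in the fibre direction is multiplication by
`P`**: `fderivExpChart (z, c) (0, b) = P z c * b` (complex-linear in `b`; cf.
`hasDerivAt_expChart`). [folklore] -/
theorem fderivExpChart_apply_zero_left (z c b : ℂ) :
    fderivExpChart (z, c) (0, b) = P z c * b := by
  rcases eq_or_ne (den z c) 0 with h | h
  · rw [fderivExpChart_apply, P, h]
    simp
  · have key : den z c + (z * (1 + (Complex.normSq z : ℂ)) + c) * conj z =
        (1 + (Complex.normSq z : ℂ)) ^ 2 := by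
      simp only [den, ← Complex.mul_conj]
      ring
    rw [fderivExpChart_apply, P, ← key]
    simp only [map_zero, zero_mul, mul_zero, add_zero, zero_add, sub_zero, zero_sub]
    field_simp
    ring

namespace SphereACData

variable (𝒥 : SphereACData)

/-! ### Smooth data: the base curve and the variation field -/

/-- For a continuous vector field `ξ₁` the set `{z | den z (ξ₁ z) ≠ 0}` (where the map stays in
the chart) is open. [folklore] -/
theorem _root_.Literature.Geometry.Symplectic.SphereCR.isOpen_den_apply_ne_zero {ξ₁ : ℂ → ℂ}
    (hξ₁ : Continuous ξ₁) : IsOpen {z : ℂ | den z (ξ₁ z) ≠ 0} :=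
  isOpen_den_ne_zero.preimage (continuous_id.prodMk hξ₁)

/-- For smooth `ξ₁, f₁` the chart-`0` map `vmap₀ ξ₁ f₁` is smooth on `{den z (ξ₁ z) ≠ 0}`.
[folklore] -/
theorem contDiffOn_vmap₀ {ξ₁ f₁ : ℂ → ℂ} (hξ₁ : ContDiff ℝ ∞ ξ₁) (hf₁ : ContDiff ℝ ∞ f₁) :
    ContDiffOn ℝ ∞ (𝒥.vmap₀ ξ₁ f₁) {z : ℂ | den z (ξ₁ z) ≠ 0} := by
  intro z hz
  have hz' : ((z, (ξ₁ z, f₁ z)) : ℂ × (ℂ × ℂ)) ∈ {p : ℂ × (ℂ × ℂ) | den p.1 p.2.1 ≠ 0} := hz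
  exact (ContDiffAt.comp (g := 𝒥.vmapPt₀) (f := fun z => (z, (ξ₁ z, f₁ z))) z
    (𝒥.contDiffOn_vmapPt₀.contDiffAt (isOpen_vmapPt₀_dom.mem_nhds hz'))
    (contDiffAt_id.prodMk (hξ₁.contDiffAt.prodMk hf₁.contDiffAt))).contDiffWithinAt

/-- The variation field in terms of `P`:
`dvmap₀ ξ₁ δξ δf z = (P z (ξ₁ z) * δξ z, Q₀(z)⁻¹ (δf z))`. [folklore] -/
theorem dvmap₀_eq_P_mul (ξ₁ δξ δf : ℂ → ℂ) (z : ℂ) :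
    𝒥.dvmap₀ ξ₁ δξ δf z = (P z (ξ₁ z) * δξ z, 𝒥.Qinv₀ z (δf z)) := by
  rw [dvmap₀, fderivExpChart_apply_zero_left]

/-- `z ↦ P z (ξ₁ z)` is smooth on `{den z (ξ₁ z) ≠ 0}` for smooth `ξ₁`. [folklore] -/
theorem _root_.Literature.Geometry.Symplectic.SphereCR.contDiffOn_P_apply {ξ₁ : ℂ → ℂ}
    (hξ₁ : ContDiff ℝ ∞ ξ₁) : ContDiffOn ℝ ∞ (fun z => P z (ξ₁ z)) {z : ℂ | den z (ξ₁ z) ≠ 0} :=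
  fun z hz => (ContDiffAt.comp (g := fun q : ℂ × ℂ => P q.1 q.2) (f := fun z => (z, ξ₁ z)) z
    (contDiffAt_P hz) (contDiffAt_id.prodMk hξ₁.contDiffAt)).contDiffWithinAt

/-- `z ↦ (P z (ξ₁ z))⁻¹` is smooth on `{den z (ξ₁ z) ≠ 0}` for smooth `ξ₁`. [folklore] -/
theorem _root_.Literature.Geometry.Symplectic.SphereCR.contDiffOn_P_inv_apply {ξ₁ : ℂ → ℂ}
    (hξ₁ : ContDiff ℝ ∞ ξ₁) :
    ContDiffOn ℝ ∞ (fun z => (P z (ξ₁ z))⁻¹) {z : ℂ | den z (ξ₁ z) ≠ 0} :=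
  fun z hz => (ContDiffAt.comp (g := fun q : ℂ × ℂ => (P q.1 q.2)⁻¹) (f := fun z => (z, ξ₁ z)) z
    (contDiffAt_P_inv hz) (contDiffAt_id.prodMk hξ₁.contDiffAt)).contDiffWithinAt

/-- **The variation field has the local class of the direction**: if `δξ, δf` are of local class
`C^{j,r}` near `z₀`, `ξ₁` is smooth and `den z₀ (ξ₁ z₀) ≠ 0`, then `dvmap₀ ξ₁ δξ δf` is of local
class `C^{j,r}` near `z₀` (`r ≤ 1`). [folklore] -/
theorem locHolder_dvmap₀ {r : ℝ≥0} (hr : r ≤ 1) {j : ℕ} {ξ₁ δξ δf : ℂ → ℂ} {z₀ : ℂ}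
    (hξ₁ : ContDiff ℝ ∞ ξ₁) (hden : den z₀ (ξ₁ z₀) ≠ 0)
    (hδξ : ∃ W, MemContDiffHolder j r W ∧ W =ᶠ[𝓝 z₀] δξ)
    (hδf : ∃ W, MemContDiffHolder j r W ∧ W =ᶠ[𝓝 z₀] δf) :
    ∃ W, MemContDiffHolder j r W ∧ W =ᶠ[𝓝 z₀] 𝒥.dvmap₀ ξ₁ δξ δf := by
  -- the two coefficients, as smooth operator-valued maps near `z₀`
  have hM : ∃ W, MemContDiffHolder j r W ∧
      W =ᶠ[𝓝 z₀] fun z => ContinuousLinearMap.mul ℝ ℂ (P z (ξ₁ z)) :=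
    locHolder_of_contDiffOn hr j (isOpen_den_apply_ne_zero hξ₁.continuous)
      ((ContinuousLinearMap.mul ℝ ℂ).contDiff.comp_contDiffOn (contDiffOn_P_apply hξ₁)) hden
  have hQ : ∃ W, MemContDiffHolder j r W ∧ W =ᶠ[𝓝 z₀] 𝒥.Qinv₀ :=
    locHolder_of_contDiff hr j 𝒥.contDiff_Qinv₀_and.1
  have h := locHolder_prodMk (locHolder_clm_apply hr hM hδξ) (locHolder_clm_apply hr hQ hδf)
  refine locHolder_congr h (Eventually.of_forall fun z => ?_)
  simp only [dvmap₀_eq_P_mul, ContinuousLinearMap.mul_apply']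

/-- **The direction is recovered from the variation field**: if `dvmap₀ ξ₁ δξ δf` is of local
class `C^{j,r}` near `z₀` (`ξ₁` smooth, `den z₀ (ξ₁ z₀) ≠ 0`, `r ≤ 1`), then so are `δξ` and `δf`
(`δξ z = (P z (ξ₁ z))⁻¹ (dvmap₀ z).1` near `z₀`, `δf z = Q₀ z (dvmap₀ z).2`). [folklore] -/
theorem locHolder_of_locHolder_dvmap₀ {r : ℝ≥0} (hr : r ≤ 1) {j : ℕ} {ξ₁ δξ δf : ℂ → ℂ}
    {z₀ : ℂ} (hξ₁ : ContDiff ℝ ∞ ξ₁) (hden : den z₀ (ξ₁ z₀) ≠ 0)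
    (hη : ∃ W, MemContDiffHolder j r W ∧ W =ᶠ[𝓝 z₀] 𝒥.dvmap₀ ξ₁ δξ δf) :
    (∃ W, MemContDiffHolder j r W ∧ W =ᶠ[𝓝 z₀] δξ) ∧
      ∃ W, MemContDiffHolder j r W ∧ W =ᶠ[𝓝 z₀] δf := by
  have hU : IsOpen {z : ℂ | den z (ξ₁ z) ≠ 0} := isOpen_den_apply_ne_zero hξ₁.continuous
  constructor
  · have hM : ∃ W, MemContDiffHolder j r W ∧
        W =ᶠ[𝓝 z₀] fun z => ContinuousLinearMap.mul ℝ ℂ (P z (ξ₁ z))⁻¹ :=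
      locHolder_of_contDiffOn hr j hU
        ((ContinuousLinearMap.mul ℝ ℂ).contDiff.comp_contDiffOn (contDiffOn_P_inv_apply hξ₁)) hden
    have h1 : ∃ W, MemContDiffHolder j r W ∧ W =ᶠ[𝓝 z₀] fun z => (𝒥.dvmap₀ ξ₁ δξ δf z).1 :=
      locHolder_comp_left hr contDiff_fst hη
    refine locHolder_congr (locHolder_clm_apply hr hM h1) ?_
    filter_upwards [hU.mem_nhds hden] with z hz
    rw [ContinuousLinearMap.mul_apply', dvmap₀_eq_P_mul, inv_mul_cancel_left₀ (P_ne_zero hz)]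
  · have hQ : ∃ W, MemContDiffHolder j r W ∧ W =ᶠ[𝓝 z₀] 𝒥.Q₀ :=
      locHolder_of_contDiff hr j 𝒥.contDiff_Q₀
    have h2 : ∃ W, MemContDiffHolder j r W ∧ W =ᶠ[𝓝 z₀] fun z => (𝒥.dvmap₀ ξ₁ δξ δf z).2 :=
      locHolder_comp_left hr contDiff_snd hη
    refine locHolder_congr (locHolder_clm_apply hr hQ h2) (Eventually.of_forall fun z => ?_)
    simp [dvmap₀]

/-! ### Linear regularity for the linearised Cauchy–Riemann operator along a smooth curve -/

/-- **Linear elliptic regularity for the linearised Cauchy–Riemann operator.** Let `0 < r < 1`,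
let `v : ℂ → ℂ × ℂ` be `C^∞` on an open neighbourhood `U` of `z₀`, let `η` be of local class
`C^{1,r}` and `E` of local class `C^{m,r}` near `z₀`, and assume the linearised equation
`∂ₓη + J₀(v) ∂_yη + (DJ₀(v) η) ∂_y v = E` near `z₀`. Then `η` is of local class `C^{m+1,r}` near
`z₀`. Proof: transport to `ℝ⁴` by the fixed isomorphism `toE4`; `u = toE4 ∘ η` solves
`∂ₓu + A ∂_y u = F` with `A = coefE4 ∘ v` smooth and `F = toE4 (E - (DJ₀(v) η) ∂_y v)` of the
class `min (m, class of η)`; the bootstrapping `locHolder_succ_of_linearCR` (with the Cauchy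
transform estimate `cauchyTransformHolderApriori_of_lt_one`) raises the class of `u` one step at a
time up to `m + 1`. [cite: McDuffSalamon2012, Thm B.4.1] -/
theorem locHolder_succ_of_linearisedCR {r : ℝ≥0} (hr0 : 0 < r) (hr1 : r < 1)
    {v η E : ℂ → ℂ × ℂ} {U : Set ℂ} {z₀ : ℂ} {m : ℕ} (hU : IsOpen U) (hv : ContDiffOn ℝ ∞ v U)
    (h0 : z₀ ∈ U) (hη : ∃ W, MemContDiffHolder 1 r W ∧ W =ᶠ[𝓝 z₀] η)
    (hE : ∃ W, MemContDiffHolder m r W ∧ W =ᶠ[𝓝 z₀] E)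
    (heq : ∀ᶠ z in 𝓝 z₀, fderiv ℝ η z 1 + 𝒥.J₀ (v z) (fderiv ℝ η z I) +
      (fderiv ℝ 𝒥.J₀ (v z) (η z)) (fderiv ℝ v z I) = E z) :
    ∃ W, MemContDiffHolder (m + 1) r W ∧ W =ᶠ[𝓝 z₀] η := by
  have hr1' : r ≤ 1 := hr1.le
  have hT : CauchyTransformHolderApriori (ℂ × ℂ) r :=
    cauchyTransformHolderApriori_of_lt_one (ℂ × ℂ) hr0 hr1
  -- the coefficients `A = coefE4 ∘ v` (smooth near `z₀`, linear complex structures)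
  set A : ℂ → EuclideanSpace ℝ (Fin 4) →L[ℝ] EuclideanSpace ℝ (Fin 4) := fun z => 𝒥.coefE4 (v z)
    with hA_def
  have hA2 : ∀ z w, A z (A z w) = -w := fun z w => 𝒥.coefE4_sq _ _
  have hA : ∀ k, ∃ W, MemContDiffHolder k r W ∧ W =ᶠ[𝓝 z₀] A := fun k =>
    locHolder_of_contDiffOn hr1' k hU (𝒥.contDiff_coefE4.comp_contDiffOn hv) h0
  -- the zeroth-order term `(DJ₀(v z) (η z)) (∂_y v z)`: its two smooth ingredients
  have hDJ : ∀ k, ∃ W, MemContDiffHolder k r W ∧ W =ᶠ[𝓝 z₀] fun z => fderiv ℝ 𝒥.J₀ (v z) :=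
    fun k => locHolder_of_contDiffOn hr1' k hU
      ((𝒥.smooth₀.fderiv_right le_rfl).comp_contDiffOn hv) h0
  have hDv : ∀ k, ∃ W, MemContDiffHolder k r W ∧ W =ᶠ[𝓝 z₀] fun z => fderiv ℝ v z I :=
    fun k => locHolder_of_contDiffOn hr1' k hU
      ((hv.fderiv_of_isOpen hU le_rfl).clm_apply contDiffOn_const) h0
  -- the transported unknown and the transported equation
  set u : ℂ → EuclideanSpace ℝ (Fin 4) := toE4 ∘ η with hu_def
  set F : ℂ → EuclideanSpace ℝ (Fin 4) := fun z =>
    toE4 (E z - (fderiv ℝ 𝒥.J₀ (v z) (η z)) (fderiv ℝ v z I)) with hF_def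
  have hu1 : ∃ W, MemContDiffHolder 1 r W ∧ W =ᶠ[𝓝 z₀] u :=
    locHolder_comp_left hr1' toE4.contDiff hη
  have heq' : ∀ᶠ z in 𝓝 z₀, fderiv ℝ u z 1 + A z (fderiv ℝ u z I) = F z := by
    filter_upwards [heq] with z hz
    rw [hu_def, ContinuousLinearEquiv.comp_fderiv]
    simp only [hA_def, hF_def, coefE4, ContinuousLinearMap.coe_comp, comp_apply,
      ContinuousLinearEquiv.coe_coe, ContinuousLinearEquiv.symm_apply_apply]
    rw [← map_add, eq_sub_of_add_eq hz]
  -- the bootstrapping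
  have key : ∀ j, j ≤ m → ∃ W, MemContDiffHolder (j + 1) r W ∧ W =ᶠ[𝓝 z₀] η := by
    intro j
    induction j with
    | zero => exact fun _ => hη
    | succ j ih =>
      intro hjm
      have hηj : ∃ W, MemContDiffHolder (j + 1) r W ∧ W =ᶠ[𝓝 z₀] η := ih (Nat.le_of_succ_le hjm)
      have hC : ∃ W, MemContDiffHolder (j + 1) r W ∧
          W =ᶠ[𝓝 z₀] fun z => (fderiv ℝ 𝒥.J₀ (v z) (η z)) (fderiv ℝ v z I) :=
        locHolder_clm_apply hr1' (locHolder_clm_apply hr1' (hDJ (j + 1)) hηj) (hDv (j + 1))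
      have hF : ∃ W, MemContDiffHolder (j + 1) r W ∧ W =ᶠ[𝓝 z₀] F :=
        locHolder_comp_left hr1' toE4.contDiff (locHolder_sub (locHolder_of_le hr1' hjm hE) hC)
      have hu2 : ∃ W, MemContDiffHolder (j + 2) r W ∧ W =ᶠ[𝓝 z₀] u :=
        locHolder_succ_of_linearCR hr0 hr1 hT hA2 j u F (hA (j + 1)) hu1 hF heq'
      have h := locHolder_comp_left hr1' toE4.symm.contDiff hu2
      simpa [hu_def] using h
  exact key m le_rfl

/-! ### The transport and its inverse along smooth data -/

/-- For smooth `ξ₁, f₁` the transport `z ↦ PhiJet₀ z (ξ₁ z) (f₁ z) = Φ₀ ξ₁ f₁ z` is smooth on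
`{den z (ξ₁ z) ≠ 0}`. [folklore] -/
theorem contDiffOn_PhiJet₀_apply {ξ₁ f₁ : ℂ → ℂ} (hξ₁ : ContDiff ℝ ∞ ξ₁) (hf₁ : ContDiff ℝ ∞ f₁) :
    ContDiffOn ℝ ∞ (fun z => 𝒥.PhiJet₀ z (ξ₁ z) (f₁ z)) {z : ℂ | den z (ξ₁ z) ≠ 0} := by
  intro z hz
  have hopen : IsOpen {p : ℂ × ℂ × ℂ | den p.1 p.2.1 ≠ 0} :=
    isOpen_den_ne_zero.preimage (continuous_fst.prodMk (continuous_fst.comp continuous_snd))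
  have hz' : ((z, ξ₁ z, f₁ z) : ℂ × ℂ × ℂ) ∈ {p : ℂ × ℂ × ℂ | den p.1 p.2.1 ≠ 0} := hz
  exact (ContDiffAt.comp (g := fun p : ℂ × ℂ × ℂ => 𝒥.PhiJet₀ p.1 p.2.1 p.2.2)
    (f := fun z => (z, ξ₁ z, f₁ z)) z (𝒥.contDiffOn_PhiJet₀.contDiffAt (hopen.mem_nhds hz'))
    (contDiffAt_id.prodMk (hξ₁.contDiffAt.prodMk hf₁.contDiffAt))).contDiffWithinAt

/-- For smooth `ξ₁, f₁` the set where the map stays in the chart and the transport is invertible,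
`{z | den z (ξ₁ z) ≠ 0 ∧ IsUnit (PhiJet₀ z (ξ₁ z) (f₁ z))}`, is open. [folklore] -/
theorem isOpen_den_ne_zero_and_isUnit_PhiJet₀ {ξ₁ f₁ : ℂ → ℂ} (hξ₁ : ContDiff ℝ ∞ ξ₁)
    (hf₁ : ContDiff ℝ ∞ f₁) :
    IsOpen {z : ℂ | den z (ξ₁ z) ≠ 0 ∧ IsUnit (𝒥.PhiJet₀ z (ξ₁ z) (f₁ z))} :=
  (𝒥.contDiffOn_PhiJet₀_apply hξ₁ hf₁).continuousOn.isOpen_inter_preimage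
    (isOpen_den_apply_ne_zero hξ₁.continuous) Units.isOpen

/-- For smooth `ξ₁, f₁` the inverse transport `z ↦ (PhiJet₀ z (ξ₁ z) (f₁ z))⁻¹` is smooth on
`{z | den z (ξ₁ z) ≠ 0 ∧ IsUnit (PhiJet₀ z (ξ₁ z) (f₁ z))}` (smoothness of inversion at the units
of the Banach algebra `End_ℝ(ℂ × ℂ)`). [folklore] -/
theorem contDiffOn_inverse_PhiJet₀_apply {ξ₁ f₁ : ℂ → ℂ} (hξ₁ : ContDiff ℝ ∞ ξ₁)
    (hf₁ : ContDiff ℝ ∞ f₁) :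
    ContDiffOn ℝ ∞ (fun z => Ring.inverse (𝒥.PhiJet₀ z (ξ₁ z) (f₁ z)))
      {z : ℂ | den z (ξ₁ z) ≠ 0 ∧ IsUnit (𝒥.PhiJet₀ z (ξ₁ z) (f₁ z))} := by
  intro z hz
  obtain ⟨w, hw⟩ := hz.2
  have h1 : ContDiffAt ℝ ∞ Ring.inverse (𝒥.PhiJet₀ z (ξ₁ z) (f₁ z)) :=
    hw ▸ contDiffAt_ringInverse ℝ w
  have h2 : ContDiffAt ℝ ∞ (fun z => 𝒥.PhiJet₀ z (ξ₁ z) (f₁ z)) z :=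
    (𝒥.contDiffOn_PhiJet₀_apply hξ₁ hf₁).contDiffAt
      ((isOpen_den_apply_ne_zero hξ₁.continuous).mem_nhds hz.1)
  exact (h1.comp z h2).contDiffWithinAt

/-! ### Linear regularity for the linearised chart equation -/

/-- **Linear elliptic regularity for the linearised chart equation at a smooth small solution.**
Let `0 < r < 1`, let `ξ₁, f₁ : ℂ → ℂ` be smooth with `den z (ξ₁ z) ≠ 0` and the transport
`PhiJet₀ z (ξ₁ z) (f₁ z) = Φ₀ ξ₁ f₁ z` invertible near `z₀`, let `ρ` be a smooth real function
with `ρ z₀ ≠ 0`, and let the direction `(δξ, δf)` be of local class `C^{1,r}` near `z₀`. If the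
linearised chart equation in first-variation form (`hasDerivAt_crOp₀_variation`)
`ρ • Φ₀ (∂ₓη + J₀(v₁) ∂_yη + (DJ₀(v₁) η) ∂_y v₁) = G` holds near `z₀`, with the variation field
`η = dvmap₀ ξ₁ δξ δf`, the base curve `v₁ = vmap₀ ξ₁ f₁` and a right-hand side `G` of local
class `C^{m,r}` near `z₀`, then `δξ` and `δf` are of local class `C^{m+1,r}` near `z₀`.
Proof: invert `ρ Φ₀` (smooth with smooth inverse near `z₀`), apply the linear regularity of the
linearised Cauchy–Riemann operator (`locHolder_succ_of_linearisedCR`) to `η`, and recover the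
direction from `η` (`locHolder_of_locHolder_dvmap₀`). [cite: McDuffSalamon2012, Thm B.4.1] -/
theorem locHolder_succ_of_linearised {r : ℝ≥0} (hr0 : 0 < r) (hr1 : r < 1)
    {ξ₁ f₁ δξ δf : ℂ → ℂ} {G : ℂ → ℂ × ℂ} {ρ : ℂ → ℝ} {z₀ : ℂ} {m : ℕ}
    (hξ₁ : ContDiff ℝ ∞ ξ₁) (hf₁ : ContDiff ℝ ∞ f₁)
    (hunit : ∀ᶠ z in 𝓝 z₀, den z (ξ₁ z) ≠ 0 ∧ IsUnit (𝒥.PhiJet₀ z (ξ₁ z) (f₁ z)))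
    (hρ : ContDiff ℝ ∞ ρ) (hρ0 : ρ z₀ ≠ 0)
    (hδξ : ∃ W, MemContDiffHolder 1 r W ∧ W =ᶠ[𝓝 z₀] δξ)
    (hδf : ∃ W, MemContDiffHolder 1 r W ∧ W =ᶠ[𝓝 z₀] δf)
    (hG : ∃ W, MemContDiffHolder m r W ∧ W =ᶠ[𝓝 z₀] G)
    (hpde : ∀ᶠ z in 𝓝 z₀, ρ z • 𝒥.Phi₀ ξ₁ f₁ z (fderiv ℝ (𝒥.dvmap₀ ξ₁ δξ δf) z 1 +
        𝒥.J₀ (𝒥.vmap₀ ξ₁ f₁ z) (fderiv ℝ (𝒥.dvmap₀ ξ₁ δξ δf) z I) +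
          (fderiv ℝ 𝒥.J₀ (𝒥.vmap₀ ξ₁ f₁ z) (𝒥.dvmap₀ ξ₁ δξ δf z))
            (fderiv ℝ (𝒥.vmap₀ ξ₁ f₁) z I)) = G z) :
    (∃ W, MemContDiffHolder (m + 1) r W ∧ W =ᶠ[𝓝 z₀] δξ) ∧
      ∃ W, MemContDiffHolder (m + 1) r W ∧ W =ᶠ[𝓝 z₀] δf := by
  have hr1' : r ≤ 1 := hr1.le
  obtain ⟨hden0, hunit0⟩ := hunit.self_of_nhds
  have hU : IsOpen {z : ℂ | den z (ξ₁ z) ≠ 0} := isOpen_den_apply_ne_zero hξ₁.continuous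
  -- the variation field is of local class `C^{1,r}`
  have hη : ∃ W, MemContDiffHolder 1 r W ∧ W =ᶠ[𝓝 z₀] 𝒥.dvmap₀ ξ₁ δξ δf :=
    𝒥.locHolder_dvmap₀ hr1' hξ₁ hden0 hδξ hδf
  -- the inverted right-hand side `E z = Φ₀(z)⁻¹ ((ρ z)⁻¹ • G z)` is of local class `C^{m,r}`
  set R : ℂ → (ℂ × ℂ →L[ℝ] ℂ × ℂ) := fun z => Ring.inverse (𝒥.PhiJet₀ z (ξ₁ z) (f₁ z))
    with hR_def
  set S : ℂ → (ℂ × ℂ →L[ℝ] ℂ × ℂ) := fun z => (ρ z)⁻¹ • ContinuousLinearMap.id ℝ (ℂ × ℂ)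
    with hS_def
  have hR : ∃ W, MemContDiffHolder m r W ∧ W =ᶠ[𝓝 z₀] R :=
    locHolder_of_contDiffOn hr1' m (𝒥.isOpen_den_ne_zero_and_isUnit_PhiJet₀ hξ₁ hf₁)
      (𝒥.contDiffOn_inverse_PhiJet₀_apply hξ₁ hf₁) ⟨hden0, hunit0⟩
  have hS : ∃ W, MemContDiffHolder m r W ∧ W =ᶠ[𝓝 z₀] S :=
    locHolder_of_contDiffOn hr1' m (isOpen_ne_fun hρ.continuous continuous_const)
      ((hρ.contDiffOn.inv fun z hz => hz).smul contDiffOn_const) hρ0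
  have hE : ∃ W, MemContDiffHolder m r W ∧ W =ᶠ[𝓝 z₀] fun z => R z (S z (G z)) :=
    locHolder_clm_apply hr1' hR (locHolder_clm_apply hr1' hS hG)
  -- the equation with the inverted right-hand side
  have hρev : ∀ᶠ z in 𝓝 z₀, ρ z ≠ 0 := hρ.continuous.continuousAt.eventually_ne hρ0
  have heq : ∀ᶠ z in 𝓝 z₀, fderiv ℝ (𝒥.dvmap₀ ξ₁ δξ δf) z 1 +
      𝒥.J₀ (𝒥.vmap₀ ξ₁ f₁ z) (fderiv ℝ (𝒥.dvmap₀ ξ₁ δξ δf) z I) +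
        (fderiv ℝ 𝒥.J₀ (𝒥.vmap₀ ξ₁ f₁ z) (𝒥.dvmap₀ ξ₁ δξ δf z))
          (fderiv ℝ (𝒥.vmap₀ ξ₁ f₁) z I) = R z (S z (G z)) := by
    filter_upwards [hpde, hunit, hρev] with z hz hu hρz
    rw [← hz]
    simp only [hS_def, hR_def, smul_apply, ContinuousLinearMap.coe_id', id_eq,
      inv_smul_smul₀ hρz]
    rw [Phi₀_eq_PhiJet₀, ← mul_apply_eq_comp, Ring.inverse_mul_cancel _ hu.2, one_apply_eq_self]
  -- linear regularity for `η`, and recovery of the direction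
  exact 𝒥.locHolder_of_locHolder_dvmap₀ hr1' hξ₁ hden0
    (𝒥.locHolder_succ_of_linearisedCR hr0 hr1 hU (𝒥.contDiffOn_vmap₀ hξ₁ hf₁) hden0 hη hE heq)

/-! ### Chart `1` -/

/-- The chart-`1` variation field is `swap.dvmap₀`:
`swap.dvmap₀ ξ₁ δξ δf w = (D(expChart)(w, ξ₁ w) (0, δξ w), Q₁(w)⁻¹ (δf w))`. [folklore] -/
theorem swap_dvmap₀_apply (ξ₁ δξ δf : ℂ → ℂ) (w : ℂ) :
    𝒥.swap.dvmap₀ ξ₁ δξ δf w = (fderivExpChart (w, ξ₁ w) (0, δξ w), 𝒥.Qinv₁ w (δf w)) := rfl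

/-- `PhiJet₁ = swap.PhiJet₀`. [folklore] -/
theorem swap_PhiJet₀ : 𝒥.swap.PhiJet₀ = 𝒥.PhiJet₁ := rfl

/-- **Linear elliptic regularity for the linearised chart equation, chart `1`**: the statement
`locHolder_succ_of_linearised` for the swapped data `𝒥.swap`, read through `swap_Phi₀`,
`swap_vmap₀`, `swap_J₀`, `swap_PhiJet₀` (the chart-`1` variation field is `swap.dvmap₀`, see
`swap_dvmap₀_apply`). [cite: McDuffSalamon2012, Thm B.4.1] -/
theorem locHolder_succ_of_linearised₁ {r : ℝ≥0} (hr0 : 0 < r) (hr1 : r < 1)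
    {ξ₁ f₁ δξ δf : ℂ → ℂ} {G : ℂ → ℂ × ℂ} {ρ : ℂ → ℝ} {w₀ : ℂ} {m : ℕ}
    (hξ₁ : ContDiff ℝ ∞ ξ₁) (hf₁ : ContDiff ℝ ∞ f₁)
    (hunit : ∀ᶠ w in 𝓝 w₀, den w (ξ₁ w) ≠ 0 ∧ IsUnit (𝒥.PhiJet₁ w (ξ₁ w) (f₁ w)))
    (hρ : ContDiff ℝ ∞ ρ) (hρ0 : ρ w₀ ≠ 0)
    (hδξ : ∃ W, MemContDiffHolder 1 r W ∧ W =ᶠ[𝓝 w₀] δξ)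
    (hδf : ∃ W, MemContDiffHolder 1 r W ∧ W =ᶠ[𝓝 w₀] δf)
    (hG : ∃ W, MemContDiffHolder m r W ∧ W =ᶠ[𝓝 w₀] G)
    (hpde : ∀ᶠ w in 𝓝 w₀, ρ w • 𝒥.Phi₁ ξ₁ f₁ w (fderiv ℝ (𝒥.swap.dvmap₀ ξ₁ δξ δf) w 1 +
        𝒥.J₁ (𝒥.vmap₁ ξ₁ f₁ w) (fderiv ℝ (𝒥.swap.dvmap₀ ξ₁ δξ δf) w I) +
          (fderiv ℝ 𝒥.J₁ (𝒥.vmap₁ ξ₁ f₁ w) (𝒥.swap.dvmap₀ ξ₁ δξ δf w))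
            (fderiv ℝ (𝒥.vmap₁ ξ₁ f₁) w I)) = G w) :
    (∃ W, MemContDiffHolder (m + 1) r W ∧ W =ᶠ[𝓝 w₀] δξ) ∧
      ∃ W, MemContDiffHolder (m + 1) r W ∧ W =ᶠ[𝓝 w₀] δf :=
  𝒥.swap.locHolder_succ_of_linearised hr0 hr1 hξ₁ hf₁ hunit hρ hρ0 hδξ hδf hG hpde

end SphereACData

end SphereCR

end Literature.Geometry.Symplectic

end
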